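import Literature.Analysis.PDE.WeightedPoincareBoundary
import HarnessLib

/-!
# Weighted Poincaré inequalities near a spherical boundary: functions and their gradients
# (Chruściel–Delay 2003, proof of Thm. 5.9: Prop. C.4 applied to `N` and to `∇N`)

The `N`-part of the boundary coercivity estimate (3.4) in the proof of
Chruściel–Delay 2003, Thm. 5.9 (p. 29): with `x = ρ − |z − z₀|` the distance to the sphere
`∂B(z₀, ρ)` and the weight `e^{−2s/x} x^{2t}`, Prop. C.4
(`WeightedPoincareBoundary.integral_shell_weight_mul_sq_le`) applied to `u := N` (exponent `t`)
and to `u := ∂ₖN` (exponent `t + 2`) gives, for `N ∈ C²_c` supported in a thin shell,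

  `(s² − ε) ∫ e^{−2s/x} x^{2t−4} N² ≤ ∫ e^{−2s/x} x^{2t} |∇N|²`,
  `(s² − ε) ∫ e^{−2s/x} x^{2t} (∂ₖN)² ≤ ∫ e^{−2s/x} x^{2t+4} |∇∂ₖN|²`,

i.e. `‖N‖_{H¹_{x²,ψ}} ≲ ‖x⁴ ∇∇N‖_{L²_ψ}` in the notation of [ChruscielDelay2003, §5]. (The printed
proof applies C.4 to `x²∇N` at the fixed exponent; since C.4 holds for every exponent `t`, applying
it at `t + 2` avoids the product rule.)

Everything is proved; no statements of `Prop` type are introduced.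

## References

* P. T. Chruściel, E. Delay, Mém. Soc. Math. Fr. 94 (2003), proof of Thm. 5.9 (p. 29) and
  Appendix C, Prop. C.4. [ChruscielDelay2003]
-/

noncomputable section

open Set Function Filter MeasureTheory Metric
open scoped Topology ContDiff

namespace Literature.Analysis.PDE

namespace WeightedPoincare

variable {E : Type*} [NormedAddCommGroup E] [InnerProductSpace ℝ E] [FiniteDimensional ℝ E]
  [MeasurableSpace E] [BorelSpace E] {ι : Type*} [Fintype ι] (b : OrthonormalBasis ι ℝ E)

/-- **Chruściel–Delay 2003, proof of Thm. 5.9 (`N`-part of (3.4)), flat ball**: for `s, t ∈ ℝ`,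
`ε > 0` there is `x₁ ∈ (0, ρ/2]` such that for every `N ∈ C²_c` supported in the shell
`{ρ − x₁ < |z − z₀| < ρ}` (`x = ρ − |z − z₀|`):
`(s² − ε) ∫ e^{−2s/x} x^{2t−4} N² ≤ ∫ e^{−2s/x} x^{2t} Σₖ(∂ₖN)²` and, for every `k`,
`(s² − ε) ∫ e^{−2s/x} x^{2t} (∂ₖN)² ≤ ∫ e^{−2s/x} x^{2t+4} Σᵢ(∂ᵢ∂ₖN)²`.
[cite: ChruscielDelay2003, proof of Thm. 5.9, p. 29; Appendix C, Prop. C.4] -/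
theorem integral_shell_weight_sq_and_gradSq_le (z₀ : E) {ρ : ℝ} (hρ : 0 < ρ) (s t : ℝ) {ε : ℝ}
    (hε : 0 < ε) :
    ∃ x₁ : ℝ, 0 < x₁ ∧ x₁ ≤ ρ / 2 ∧ ∀ N : E → ℝ, ContDiff ℝ 2 N → HasCompactSupport N →
      tsupport N ⊆ {z | ρ - x₁ < ‖z - z₀‖ ∧ ‖z - z₀‖ < ρ} →
      (s ^ 2 - ε) * ∫ z, Real.exp (-2 * s / (ρ - ‖z - z₀‖)) * (ρ - ‖z - z₀‖) ^ (2 * t - 4) *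
          N z ^ 2 ≤
        ∫ z, Real.exp (-2 * s / (ρ - ‖z - z₀‖)) * (ρ - ‖z - z₀‖) ^ (2 * t) *
          ∑ i, fderiv ℝ N z (b i) ^ 2 ∧
      ∀ k, (s ^ 2 - ε) * ∫ z, Real.exp (-2 * s / (ρ - ‖z - z₀‖)) * (ρ - ‖z - z₀‖) ^ (2 * t) *
          fderiv ℝ N z (b k) ^ 2 ≤
        ∫ z, Real.exp (-2 * s / (ρ - ‖z - z₀‖)) * (ρ - ‖z - z₀‖) ^ (2 * t + 4) *
          ∑ i, fderiv ℝ (fun y ↦ fderiv ℝ N y (b k)) z (b i) ^ 2 := by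
  obtain ⟨xa, hxa, hxaρ, Ha⟩ := integral_shell_weight_mul_sq_le b z₀ hρ s t hε
  obtain ⟨xb, hxb, -, Hb⟩ := integral_shell_weight_mul_sq_le b z₀ hρ s (t + 2) hε
  refine ⟨min xa xb, lt_min hxa hxb, (min_le_left _ _).trans hxaρ, fun N hN hNc hNS ↦ ⟨?_, ?_⟩⟩
  · refine Ha N (hN.of_le (by norm_cast)) hNc (hNS.trans fun z hz ↦ ⟨?_, hz.2⟩)
    linarith [hz.1, min_le_left xa xb]
  · intro k
    have hu : ContDiff ℝ 1 fun y ↦ fderiv ℝ N y (b k) :=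
      (hN.fderiv_right (m := 1) (by norm_cast)).clm_apply contDiff_const
    have huc : HasCompactSupport fun y ↦ fderiv ℝ N y (b k) := hNc.fderiv_apply (𝕜 := ℝ) (b k)
    have huS : tsupport (fun y ↦ fderiv ℝ N y (b k)) ⊆ {z | ρ - xb < ‖z - z₀‖ ∧ ‖z - z₀‖ < ρ} :=
      ((tsupport_fderiv_apply_subset ℝ (b k)).trans hNS).trans fun z hz ↦
        ⟨by linarith [hz.1, min_le_right xa xb], hz.2⟩
    have h := Hb _ hu huc huS
    rw [show 2 * (t + 2) - 4 = 2 * t by ring, show 2 * (t + 2) = 2 * t + 4 by ring] at h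
    exact h

end WeightedPoincare

end Literature.Analysis.PDE
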